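import Mathlib
import HarnessLib

/-!
# Vocabulary of line `Sketch` for the crux `EngineToPairs` (stmt-Parity-14659)

Route `LiouvilleShiftedTables` (Parity / GeneralizedHardyLittlewood), crux decl
`Summit.Parity.GeneralizedHardyLittlewood.Theses.LiouvilleShiftedTables.EngineToPairs` (rank 6, XL glue):
`DilatedTableChowla → TypeI2Dilated → ElliottHalberstam → PairsHL`.

This is the DEFINITIONS file of the line (registered skeleton `Cruxes/EngineToPairs/Lines/Sketch.lean`):
the route-posited intermediate statements that the stubs of the skeleton prove and consume.  No theorem
of substance lives here; every `def … : Prop` below is an OBLIGATION of the line (proved by a stub file under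
`Theorems/`) or the type of a hypothesis of such an obligation.

Shape of the line (cards `bfi-transplant-correlation-sieve` + `tavg-hinge-gy-normal-form`, triage r1):

* the HINGE `TAvg` (`TAvgAt h`): `λ` of the shifted primes in progressions, `ℓ¹`-averaged over ALL moduli
  `q ≤ x^ε` at a common height `y ≤ x` — the native output of a sieve on the correlation functional and the
  input of the `k²`-trick `TAvg → MAvg` (`μ(d) = λ(d) ∑_{k² ∣ d} μ(k)`, single height);
* the weight family `shiftWeight h q n = 1[n ≡ h (q)] · λ(n − h)` and the coprime moduli `moduliH h Q`;
* Ford–Maynard-shaped information predicates for a FAMILY of weights `w q ·` indexed by `q ∈ Qs`, with the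
  sharp cut-off `x/2 < n ≤ x` inside and explicit budgets: `TypeIFam` (level `x^γ`, one interval per `(q, m)`),
  `TypeIIFam` (bilinear, `m` in the window `((x/2)^θ, x^{θ+ν}]`, divisor-bounded coefficients), `TypeI2Fam`
  (the region shape of the crux `TypeI2Dilated`: `r ≤ R ≤ x^ρ` with divisor weights and absolute values,
  `s ≤ S` flat, `n ≤ y/(sr)` hyperbolic, `SR ≤ x^{1/2+σ}`, COMMON `(R, S, y)` across the family);
* `CorrelationSieveFamily` — the weight-agnostic correlation-sieve inequality (Heath-Brown `K = 3`, dyadic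
  boxes, exponent trichotomy): Type-I information of level `x^{1/2−2δ}`, Type-II information on
  `[δ/2, 1/3+δ]` and Type-I₂ information in the box `r ≤ x^δ`, `SR ≤ x^{1/2+3δ}` bound
  `∑_{q} |∑_{x/2<n≤x} Λ(n) w_q(n)|` by `C (log x)^C (TI + TII + TI2)`;
* the three BUDGET statements `TIBudget`, `TIIBudget`, `TI2Budget` — what the leaves `BVLiouville` (proved),
  `DilatedTableChowla` (X1) and `TypeI2Dilated` (X2) deliver for the family `shiftWeight h` over `moduliH`.

Composition (the skeleton's `EngineToPairs_of`): `PairsFromMAvg hE (MAvg_of_TAvg (TAvg_of_parts sieve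
(TI_of_BV BVLiouville_proof) (TII_of_X1 hD) (TI2_of_X2 hI)))`.
-/

noncomputable section

namespace Summit.Parity.GeneralizedHardyLittlewood.Theorems.EngineToPairs

open Finset Real
open scoped ArithmeticFunction.vonMangoldt

/-! ### The hinge -/

/-- The hinge at one shift `h`: there is `ε > 0` such that for every `A`, uniformly in the common height
`0 ≤ y ≤ x`, `∑_{q ≤ x^ε} |∑_{n ≤ y, n ≡ h (q)} Λ(n) λ(n − h)| ≤ C x (log x)^{−A}` for `x ≥ x₀`.
All moduli `q` (not only `(q, h) = 1`); truncated subtraction (`λ(n − h) = λ(0) = 0` for `n ≤ h`).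
[this line; cards bfi-transplant-correlation-sieve, tavg-hinge-gy-normal-form] -/
def TAvgAt (h : ℕ) : Prop :=
  ∃ ε : ℝ, 0 < ε ∧ ∀ A : ℝ, 0 < A → ∃ C x₀ : ℝ, ∀ x : ℝ, x₀ ≤ x → ∀ y : ℝ, 0 ≤ y → y ≤ x →
    ∑ q ∈ Icc 1 ⌊x ^ ε⌋₊,
        |∑ n ∈ (Icc 1 ⌊y⌋₊).filter (fun n : ℕ => n ≡ h [MOD q]),
            Λ n * (ArithmeticFunction.liouville (n - h) : ℝ)| ≤ C * x / Real.log x ^ A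

/-- The hinge `TAvg`: `TAvgAt h` for every shift `h ≥ 1`. [this line] -/
def TAvg : Prop := ∀ h : ℕ, 1 ≤ h → TAvgAt h

/-! ### The weight family and its moduli -/

/-- The shifted class weight `w_{h,q}(n) = 1[n ≡ h (mod q)] · λ(n − h)` (truncated subtraction). [this line] -/
def shiftWeight (h q n : ℕ) : ℝ :=
  if n ≡ h [MOD q] then (ArithmeticFunction.liouville (n - h) : ℝ) else 0

/-- The moduli `1 ≤ q ≤ Q` coprime to `h`. [folklore] -/
def moduliH (h : ℕ) (Q : ℝ) : Finset ℕ := (Icc 1 ⌊Q⌋₊).filter (fun q : ℕ => Nat.Coprime q h)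

/-- The divisor weight `τ(m)^B`. [folklore] -/
def tauPow (B m : ℕ) : ℝ := ((Nat.divisors m).card : ℝ) ^ B

/-! ### Information predicates for a family of weights -/

/-- Type-I information for the family `(w q)_{q ∈ Qs}` on `(x/2, x]`: level `x^γ`, divisor exponent `B`,
budget `T`; one interval `I q m` per modulus of the family and per `m` (the `max` over intervals of the
Ford–Maynard shape, as a choice function). [this line; cf. FordMaynard2024PrimeSieves (I)] -/
def TypeIFam (Qs : Finset ℕ) (w : ℕ → ℕ → ℝ) (x γ : ℝ) (B : ℕ) (T : ℝ) : Prop :=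
  ∀ I : ℕ → ℕ → ℕ × ℕ,
    ∑ q ∈ Qs, ∑ m ∈ Icc 1 ⌊x ^ γ⌋₊, tauPow B m *
        |∑ n ∈ (Icc (I q m).1 (I q m).2).filter
            (fun n : ℕ => x / 2 < (m : ℝ) * n ∧ (m : ℝ) * n ≤ x), w q (m * n)| ≤ T

/-- Type-II information for the family `(w q)_{q ∈ Qs}` on `(x/2, x]`: `m` in the window
`((x/2)^θ, x^{θ+ν}]`, coefficients bounded by `τ^B` (the same for every `q`), the product condition
`x/2 < mn ≤ x` inside, budget `T`. [this line; cf. FordMaynard2024PrimeSieves (II)] -/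
def TypeIIFam (Qs : Finset ℕ) (w : ℕ → ℕ → ℝ) (x θ ν : ℝ) (B : ℕ) (T : ℝ) : Prop :=
  ∀ ξ κ : ℕ → ℝ, (∀ m, |ξ m| ≤ tauPow B m) → (∀ n, |κ n| ≤ tauPow B n) →
    ∑ q ∈ Qs,
        |∑ m ∈ (Icc 1 ⌊x ^ (θ + ν)⌋₊).filter (fun m : ℕ => (x / 2) ^ θ < (m : ℝ)),
            ∑ n ∈ (Icc 1 ⌊x⌋₊).filter (fun n : ℕ => x / 2 < (m : ℝ) * n ∧ (m : ℝ) * n ≤ x),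
              ξ m * κ n * w q (m * n)| ≤ T

/-- Type-I₂ information for the family `(w q)_{q ∈ Qs}` on `(x/2, x]`: a rough outer variable
`r ≤ R ≤ x^ρ` with divisor weights and absolute values, a FLAT smooth variable `s ≤ S` and a HYPERBOLIC
smooth variable `n ≤ y/(sr)` (both with coefficient `1`), `SR ≤ x^{1/2+σ}`, heights `y ≤ x`, the parameters
`(R, S, y)` COMMON to the whole family — the region shape of the crux `TypeI2Dilated`. [this line] -/
def TypeI2Fam (Qs : Finset ℕ) (w : ℕ → ℕ → ℝ) (x ρ σ : ℝ) (B : ℕ) (T : ℝ) : Prop :=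
  ∀ R S y : ℝ, 1 ≤ R → R ≤ x ^ ρ → 0 ≤ S → S * R ≤ x ^ (1 / 2 + σ) → 0 ≤ y → y ≤ x →
    ∑ q ∈ Qs, ∑ r ∈ Icc 1 ⌊R⌋₊, tauPow B r *
        |∑ s ∈ Icc 1 ⌊S⌋₊, ∑ n ∈ (Icc 1 ⌊y / (s * r)⌋₊).filter
            (fun n : ℕ => x / 2 < (r : ℝ) * s * n), w q (r * s * n)| ≤ T

/-! ### The correlation-sieve inequality (the load-bearing stub of the line) -/

/-- **The weight-agnostic correlation sieve, family form.**  For `0 < δ ≤ 1/100` there are a divisor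
exponent `B` and `C, x₀` such that for `x ≥ x₀`, for EVERY finite family of `1`-bounded weights
`(w q)_{q ∈ Qs}` and budgets `TI, TII, TI2 ≥ 0`: Type-I information of level `x^{1/2−2δ}`, Type-II
information for `m ∈ ((x/2)^{δ/2}, x^{1/3+δ}]` and Type-I₂ information in the box `r ≤ x^δ`,
`SR ≤ x^{1/2+3δ}` give `∑_{q ∈ Qs} |∑_{x/2 < n ≤ x} Λ(n) w_q(n)| ≤ C (log x)^C (TI + TII + TI2)`.
Proof route: Heath-Brown's identity with `K = 3` (tree: `heathBrown_identity_nat`), dyadic boxes for all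
`≤ 6` variables (tree: `BFI.prod_apply_eq_sum_prod_boxRestrict_apply` with `Δ = 1`), the exponent
trichotomy (`BFI.exists_subsum_mem_Icc_or`): a partial product in the window ⇒ Type II; a smooth box
`≥ x^{1/2+21δ/10}` ⇒ Type I; two smooth boxes near `√x` with the rest `< x^{3δ/5}` ⇒ flat split of one of
them at `x^{1/2−2δ}/r` and `32 x^{1/2+2δ}` into Type I / Type I₂ / Type I, re-summing the dyadic boxes of
the hyperbolic variable; `log` weights by discrete Abel summation. [this line; Heathbrown1982 Lemma 1,
Harman2007 Lemma 2.8, BombieriFriedlanderIwaniecActa1986 §15, FordMaynard2024PrimeSieves §4.6] -/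
def CorrelationSieveFamily : Prop :=
  ∀ δ : ℝ, 0 < δ → δ ≤ 1 / 100 → ∃ B : ℕ, ∃ C x₀ : ℝ, ∀ x : ℝ, x₀ ≤ x →
    ∀ Qs : Finset ℕ, ∀ w : ℕ → ℕ → ℝ, (∀ q n, |w q n| ≤ 1) →
    ∀ TI TII TI2 : ℝ, 0 ≤ TI → 0 ≤ TII → 0 ≤ TI2 →
      TypeIFam Qs w x (1 / 2 - 2 * δ) B TI →
      TypeIIFam Qs w x (δ / 2) (1 / 3 + δ / 2) B TII →
      TypeI2Fam Qs w x δ (3 * δ) B TI2 →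
        ∑ q ∈ Qs, |∑ n ∈ Ioc ⌊x / 2⌋₊ ⌊x⌋₊, Λ n * w q n| ≤
          C * Real.log x ^ C * (TI + TII + TI2)

/-! ### The three budgets (what the leaves deliver for `shiftWeight h` over `moduliH h (x^ε₁)`) -/

/-- **Type-I budget** (from `BVLiouville`, proved in tree): for `h ≥ 1`, `0 < δ ≤ 1/4`, `0 < ε₁ ≤ δ`, every
`B` and `A`: `TypeIFam (moduliH h (x^ε₁)) (shiftWeight h) x (1/2 − 2δ) B (C x (log x)^{−A})` for `x ≥ x₀`
(`λ` along the progression `mq·t + (m n₀ − h)`, moduli `mq ≤ x^{1/2−2δ+ε₁}` with multiplicity `≤ τ`, worst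
residue and height per modulus by Cauchy–Schwarz against the trivial bound). [this line] -/
def TIBudget : Prop :=
  ∀ h : ℕ, 1 ≤ h → ∀ δ : ℝ, 0 < δ → δ ≤ 1 / 4 → ∀ ε₁ : ℝ, 0 < ε₁ → ε₁ ≤ δ → ∀ B : ℕ,
    ∀ A : ℝ, 0 < A → ∃ C x₀ : ℝ, ∀ x : ℝ, x₀ ≤ x →
      TypeIFam (moduliH h (x ^ ε₁)) (shiftWeight h) x (1 / 2 - 2 * δ) B (C * x / Real.log x ^ A)

/-- **Type-II budget** (from `DilatedTableChowla`): for `h ≥ 1`, `0 < δ ≤ 1/100`, `0 < ε₁ ≤ δ/5`, every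
`B` and `A`: `TypeIIFam (moduliH h (x^ε₁)) (shiftWeight h) x (δ/2) (1/3 + δ/2) B (C x (log x)^{−A})` for
`x ≥ x₀` (class blocks `u ∈ (ℤ/q)ˣ`, `(∑ αβλ)⁴ ≤ ‖α‖⁴‖β‖⁴ tr(MMᵀ)²` per block, Hölder
`∑_q q^{−3/4}(q³F)^{1/4}` against X1 at the two window parameters `2δ/5` and `δ`, separation of the
product condition by `(1+η)`-slivers in `m`). [this line] -/
def TIIBudget : Prop :=
  ∀ h : ℕ, 1 ≤ h → ∀ δ : ℝ, 0 < δ → δ ≤ 1 / 100 → ∀ ε₁ : ℝ, 0 < ε₁ → ε₁ ≤ δ / 5 → ∀ B : ℕ,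
    ∀ A : ℝ, 0 < A → ∃ C x₀ : ℝ, ∀ x : ℝ, x₀ ≤ x →
      TypeIIFam (moduliH h (x ^ ε₁)) (shiftWeight h) x (δ / 2) (1 / 3 + δ / 2) B
        (C * x / Real.log x ^ A)

/-- **Type-I₂ budget** (from `TypeI2Dilated` at `c = −h`, `w = h`): for `h ≥ 1` there is `ρ > 0` (X2's)
such that for `0 < δ`, `3δ ≤ ρ`, `0 < ε₁ ≤ ρ`, every `B` and `A`:
`TypeI2Fam (moduliH h (x^ε₁)) (shiftWeight h) x δ (3δ) B (C x (log x)^{−A})` for `x ≥ x₀` (the lower cut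
`x/2 < rsn` by differencing `y`, the divisor weight by Cauchy–Schwarz against the trivial bound). [this line] -/
def TI2Budget : Prop :=
  ∀ h : ℕ, 1 ≤ h → ∃ ρ : ℝ, 0 < ρ ∧ ∀ δ : ℝ, 0 < δ → 3 * δ ≤ ρ → ∀ ε₁ : ℝ, 0 < ε₁ → ε₁ ≤ ρ →
    ∀ B : ℕ, ∀ A : ℝ, 0 < A → ∃ C x₀ : ℝ, ∀ x : ℝ, x₀ ≤ x →
      TypeI2Fam (moduliH h (x ^ ε₁)) (shiftWeight h) x δ (3 * δ) B (C * x / Real.log x ^ A)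

/-! ### Elementary read-backs (anchors) -/

/-- `shiftWeight` is `1`-bounded. [folklore] -/
theorem abs_shiftWeight_le_one (h q n : ℕ) : |shiftWeight h q n| ≤ 1 := by
  unfold shiftWeight
  split_ifs
  · rcases eq_or_ne (n - h) 0 with h0 | h0
    · simp [h0]
    · rw [ArithmeticFunction.liouville_apply h0]
      push_cast
      rw [abs_pow, abs_neg, abs_one, one_pow]
  · simp

/-- Membership in `moduliH`. [folklore] -/
theorem mem_moduliH {h : ℕ} {Q : ℝ} {q : ℕ} :
    q ∈ moduliH h Q ↔ (1 ≤ q ∧ q ≤ ⌊Q⌋₊) ∧ Nat.Coprime q h := by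
  simp [moduliH]

/-- `tauPow` is nonnegative. [folklore] -/
theorem tauPow_nonneg (B m : ℕ) : 0 ≤ tauPow B m := by
  unfold tauPow; positivity

/-- The class-filtered correlation sum is the `shiftWeight`-weighted sum. [folklore] -/
theorem sum_filter_modEq_eq_sum_shiftWeight (h q : ℕ) (s : Finset ℕ) (F : ℕ → ℝ) :
    ∑ n ∈ s.filter (fun n : ℕ => n ≡ h [MOD q]), F n * (ArithmeticFunction.liouville (n - h) : ℝ) =
      ∑ n ∈ s, F n * shiftWeight h q n := by
  rw [Finset.sum_filter]
  refine Finset.sum_congr rfl fun n _ => ?_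
  unfold shiftWeight
  split_ifs <;> simp

end Summit.Parity.GeneralizedHardyLittlewood.Theorems.EngineToPairs

end
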